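import Summits.QuantumFields.BalabanUV.T4Continuum.Spine.NE4.FadingFromRateAnalytic

/-!
# Spine/NE4/FadingFromRateAnalyticSharp — the shapes of `FadingFromRateAnalytic` are jointly inhabited NON-TRIVIALLY, and its rate `θ`
# is EXACT: the geometric tower `β_{k+1}(g_0,…,g_k) = Σ_i θ^{k−i}·g_i`

Cell `pub-balaban-gaps` (YM blitz G2), seat `ne4`, generation 5 (unit `pub-balaban-gaps-ne4-g5`); record `HOME/ne/NE4.md` §5 (R34).  Companion of
`Spine/NE4/FadingFromRateAnalytic` (complex NE4 `ScaleShiftRateC` + coordinatewise analyticity `CoordAnalyticC` ⇒ node U2's history companions at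
rate `θ`), answering in advance the refuter's two questions about the new hypothesis shapes: are `ExtendsC`, `ScaleShiftRateC`, `CoordAnalyticC`
JOINTLY satisfiable with every inequality non-trivial, and can the derived decay rate `θ` be improved?

THE WITNESS.  The geometric tower `tower θ k (g_0,…,g_k) := Σ_{i ≤ k} θ^{k−i}·g_i` (every coupling enters, the one of age `a` with weight `θ^a`),
with its entire complex extension `towerC θ`:
 * `ExtendsC (tower θ) (towerC θ)` (`extendsC_tower`);
 * the scale shift is EXACTLY the oldest coupling's contribution, `towerC θ (k+1) w − towerC θ k (Fin.tail w) = θ^{k+1}·w_0` (`towerC_shift`), so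
   `ScaleShiftRateC (θ(γ+r)) θ γ r (towerC θ)` (`scaleShiftRateC_tower`) — complex NE4 at rate `θ`, constant `> 0`;
 * the one-coupling sections are affine, entire and bounded by `(γ+r)∕(1−θ)` on the neighbourhood: `CoordAnalyticC ((γ+r)∕(1−θ)) γ r (towerC θ)`
   (`coordAnalyticC_tower`);
 * the Lipschitz modulus in the OLDEST coupling is exactly `θ^k` (`tower_update_zero`), so EVERY `Λ` with `HistLipschitz Λ γ (tower θ)` has
   `Λ k 0 ≥ θ^k` (`moduli_lower_tower`) and `FadingMemory C θ′ Λ` FAILS for every `C` and every `θ′ < θ` (`not_fadingMemory_tower`), while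
   `FadingFromRateAnalytic.histLipschitz_fadingMemory_of_analytic` supplies fading moduli at rate `θ` (`analytic_rate_exact`).
So under {complex NE4 at rate `θ`, analyticity} the exchange rate `θ ↦ θ` of (R34) cannot be improved, exactly as `√θ` cannot under C^{1,1}
(`Spine/NE4/FadingFromRateSharp`).  (The tower is (R30)'s picture in closed form: a Markovian geometric memory of birth-indexed contributions;
cf. `T4OutputRateWitness.uvMod`.)

HONEST FRAMING: a toy family on the tree's HYPOTHESIS SHAPES; nothing of Bałaban's asserted; NE4 NOT IN PRINT, NOT PROVED; spine PROVED 0∕9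
unchanged; NOT the continuum limit on ℝ⁴, NOT infinite volume, NOT a mass gap, NOT Clay.
-/

noncomputable section

namespace Summit.QuantumFields.BalabanUV.T4Continuum.Spine.NE4

open Set Metric
open Literature.MathematicalPhysics.QuantumFieldTheory.Balaban1983to89
open Literature.MathematicalPhysics.QuantumFieldTheory.Balaban1983to89.FlowStep
open Literature.MathematicalPhysics.QuantumFieldTheory.Balaban1983to89.T4CouplingMatching

/-! ## §1 The geometric tower and its complex extension -/

/-- The GEOMETRIC TOWER over ℂ: `towerC θ k (w_0,…,w_k) = Σ_i θ^{k−i}·w_i`. [folklore] -/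
def towerC (θ : ℝ) : HBetaC := fun k w => ∑ i : Fin (k + 1), (θ : ℂ) ^ (k - (i : ℕ)) * w i

/-- Its real restriction `tower θ k (g_0,…,g_k) = Σ_i θ^{k−i}·g_i`. [folklore] -/
def tower (θ : ℝ) : HBeta := fun k v => ∑ i : Fin (k + 1), θ ^ (k - (i : ℕ)) * v i

/-- `towerC θ` extends `tower θ`. [folklore] -/
theorem extendsC_tower (θ : ℝ) : ExtendsC (tower θ) (towerC θ) := by
  intro k v
  simp only [tower, towerC, Complex.ofReal_sum, Complex.ofReal_mul, Complex.ofReal_pow]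

/-- Points of the neighbourhood `Nbhd r γ` have norm `≤ γ + r`. [folklore] -/
theorem norm_le_of_mem_nbhd {r γ : ℝ} {z : ℂ} (hz : z ∈ Nbhd r γ) : ‖z‖ ≤ γ + r := by
  obtain ⟨t, ht, hzt⟩ := hz
  have h1 : ‖(t : ℂ)‖ ≤ γ := by rw [Complex.norm_real, Real.norm_eq_abs, abs_of_pos ht.1]; exact ht.2
  calc ‖z‖ = ‖(z - (t : ℂ)) + (t : ℂ)‖ := by rw [sub_add_cancel]
    _ ≤ ‖z - (t : ℂ)‖ + ‖(t : ℂ)‖ := norm_add_le _ _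
    _ ≤ r + γ := add_le_add hzt h1
    _ = γ + r := add_comm _ _

/-- **THE SCALE SHIFT OF THE TOWER IS THE OLDEST COUPLING's CONTRIBUTION**: `towerC θ (k+1) w − towerC θ k (Fin.tail w) = θ^{k+1}·w_0` (the younger
couplings' terms cancel exactly). [folklore] -/
theorem towerC_shift (θ : ℝ) (k : ℕ) (w : Fin (k + 2) → ℂ) :
    towerC θ (k + 1) w - towerC θ k (Fin.tail w) = (θ : ℂ) ^ (k + 1) * w 0 := by
  simp only [towerC]
  rw [Fin.sum_univ_succ]
  have : ∑ i : Fin (k + 1), (θ : ℂ) ^ (k + 1 - ((Fin.succ i : Fin (k + 2)) : ℕ)) * w i.succ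
      = ∑ i : Fin (k + 1), (θ : ℂ) ^ (k - (i : ℕ)) * Fin.tail w i := by
    refine Finset.sum_congr rfl fun i _ => ?_
    simp [Fin.tail, Fin.val_succ, Nat.succ_sub_succ]
  rw [this]
  simp

/-- **COMPLEX NE4 FOR THE TOWER, RATE `θ`**: `ScaleShiftRateC (θ·(γ+r)) θ γ r (towerC θ)` (`θ ≥ 0`; the oldest entry has norm `≤ γ + r` on the
neighbourhood). [folklore] -/
theorem scaleShiftRateC_tower {θ γ r : ℝ} (hθ : 0 ≤ θ) : ScaleShiftRateC (θ * (γ + r)) θ γ r (towerC θ) := by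
  intro k w hw
  rw [towerC_shift, norm_mul, norm_pow, Complex.norm_real, Real.norm_eq_abs, abs_of_nonneg hθ]
  calc θ ^ (k + 1) * ‖w 0‖ ≤ θ ^ (k + 1) * (γ + r) := mul_le_mul_of_nonneg_left (norm_le_of_mem_nbhd (hw 0)) (pow_nonneg hθ _)
    _ = θ * (γ + r) * θ ^ k := by ring

/-- The geometric weights of one scale sum to `≤ 1∕(1−θ)` (`0 ≤ θ < 1`). [folklore] -/
theorem sum_pow_sub_le {θ : ℝ} (hθ0 : 0 ≤ θ) (hθ1 : θ < 1) (k : ℕ) :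
    ∑ i : Fin (k + 1), θ ^ (k - (i : ℕ)) ≤ 1 / (1 - θ) := by
  rw [Fin.sum_univ_eq_sum_range (fun i => θ ^ (k - i)) (k + 1)]
  have hrefl := Finset.sum_range_reflect (fun i => θ ^ i) (k + 1)
  simp only [add_tsub_cancel_right] at hrefl
  rw [hrefl, Finset.range_eq_Ico]
  simpa using geom_sum_Ico_le_of_lt_one (m := 0) (n := k + 1) hθ0 hθ1

/-- **THE SECTIONS OF THE TOWER ARE ENTIRE AND BOUNDED ON THE NEIGHBOURHOOD**: `CoordAnalyticC ((γ+r)∕(1−θ)) γ r (towerC θ)` (`0 ≤ θ < 1`,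
`γ + r ≥ 0`; open set `univ`). [folklore] -/
theorem coordAnalyticC_tower {θ γ r : ℝ} (hθ0 : 0 ≤ θ) (hθ1 : θ < 1) (hγr : 0 ≤ γ + r) :
    CoordAnalyticC ((γ + r) / (1 - θ)) γ r (towerC θ) := by
  intro k p hp i
  refine ⟨univ, isOpen_univ, subset_univ _, ?_, ?_⟩
  · -- a finite sum of (constant) × (either `z` or a constant)
    refine (Differentiable.fun_sum fun j _ => ?_).differentiableOn
    refine (differentiable_const _).mul ?_
    by_cases hj : j = i
    · subst hj; simp only [Function.update_self]; exact differentiable_id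
    · simp only [Function.update_of_ne hj]; exact differentiable_const _
  · intro z hz
    have hr : 0 ≤ r := by obtain ⟨t, -, hzt⟩ := hz; exact (norm_nonneg _).trans hzt
    have hupd : Function.update (fun j => (p j : ℂ)) i z ∈ CBox r γ k := update_mem_cbox (ofReal_mem_cbox hr hp) i hz
    have h1θ : 0 < 1 - θ := by linarith
    calc ‖towerC θ k (Function.update (fun j => (p j : ℂ)) i z)‖
        ≤ ∑ j : Fin (k + 1), ‖(θ : ℂ) ^ (k - (j : ℕ)) * Function.update (fun j => (p j : ℂ)) i z j‖ := norm_sum_le _ _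
      _ ≤ ∑ j : Fin (k + 1), θ ^ (k - (j : ℕ)) * (γ + r) := by
          refine Finset.sum_le_sum fun j _ => ?_
          rw [norm_mul, norm_pow, Complex.norm_real, Real.norm_eq_abs, abs_of_nonneg hθ0]
          exact mul_le_mul_of_nonneg_left (norm_le_of_mem_nbhd (hupd j)) (pow_nonneg hθ0 _)
      _ = (∑ j : Fin (k + 1), θ ^ (k - (j : ℕ))) * (γ + r) := by rw [Finset.sum_mul]
      _ ≤ 1 / (1 - θ) * (γ + r) := mul_le_mul_of_nonneg_right (sum_pow_sub_le hθ0 hθ1 k) hγr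
      _ = (γ + r) / (1 - θ) := by field_simp

/-! ## §2 The rate `θ` is attained: no admissible moduli fade faster -/

/-- **THE MODULUS IN THE OLDEST COUPLING IS EXACTLY `θ^k`**: `tower θ k (v with g_0 := t) − tower θ k v = θ^k·(t − v_0)`. [folklore] -/
theorem tower_update_zero (θ : ℝ) (k : ℕ) (v : Fin (k + 1) → ℝ) (t : ℝ) :
    tower θ k (Function.update v 0 t) - tower θ k v = θ ^ k * (t - v 0) := by
  simp only [tower]
  rw [Fin.sum_univ_succ, Fin.sum_univ_succ]
  have : ∑ i : Fin k, θ ^ (k - ((Fin.succ i : Fin (k + 1)) : ℕ)) * Function.update v 0 t i.succ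
      = ∑ i : Fin k, θ ^ (k - ((Fin.succ i : Fin (k + 1)) : ℕ)) * v i.succ :=
    Finset.sum_congr rfl fun i _ => by rw [Function.update_of_ne (Fin.succ_ne_zero i)]
  rw [this, Function.update_self]
  simp only [Fin.val_zero, Nat.sub_zero]
  ring

/-- **EVERY ADMISSIBLE MODULUS IS `≥ θ^k` IN THE OLDEST COUPLING**: if `HistLipschitz Λ γ (tower θ)` (`γ > 0`, `θ ≥ 0`) then `θ^k ≤ Λ k 0`
(histories `(γ∕2, γ, …, γ)` vs `(γ, …, γ)`). [folklore] -/
theorem moduli_lower_tower {θ γ : ℝ} {Λ : ℕ → ℕ → ℝ} (hγ : 0 < γ) (hθ : 0 ≤ θ) (hΛ : HistLipschitz Λ γ (tower θ)) (k : ℕ) :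
    θ ^ k ≤ Λ k 0 := by
  let p : Fin (k + 1) → ℝ := fun _ => γ
  have hp : p ∈ Box γ k := mem_box.mpr fun _ => ⟨hγ, le_rfl⟩
  have hq : Function.update p 0 (γ / 2) ∈ Box γ k := by
    rw [mem_box]; intro j
    by_cases hj : j = 0
    · subst hj; rw [Function.update_self]; constructor <;> linarith
    · rw [Function.update_of_ne hj]; exact ⟨hγ, le_rfl⟩
  have h := hΛ k (Function.update p 0 (γ / 2)) p hq hp
  rw [tower_update_zero] at h
  have hsum : ∑ i : Fin (k + 1), Λ k i * |Function.update p 0 (γ / 2) i - p i| = Λ k 0 * (γ / 2) := by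
    rw [Fin.sum_univ_succ, Function.update_self]
    have hz : ∑ i : Fin k, Λ k ((Fin.succ i : Fin (k + 1)) : ℕ) * |Function.update p 0 (γ / 2) i.succ - p i.succ| = 0 :=
      Finset.sum_eq_zero fun i _ => by rw [Function.update_of_ne (Fin.succ_ne_zero i), sub_self, abs_zero, mul_zero]
    rw [hz, add_zero]
    simp only [Fin.val_zero, p]
    rw [show γ / 2 - γ = -(γ / 2) by ring, abs_neg, abs_of_pos (by linarith)]
  rw [hsum] at h
  have hl : |θ ^ k * (γ / 2 - γ)| = θ ^ k * (γ / 2) := by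
    rw [abs_mul, abs_of_nonneg (pow_nonneg hθ _), show γ / 2 - γ = -(γ / 2) by ring, abs_neg, abs_of_pos (by linarith)]
  rw [hl] at h
  nlinarith

/-- **NO RATE BELOW `θ`**: for `γ > 0`, `0 < θ`, `θ′ < θ`, every `Λ` with `HistLipschitz Λ γ (tower θ)` and every `C`:
`¬ FadingMemory C θ′ Λ` (`θ^k ≤ Λ k 0 ≤ C·θ′^k` for all `k` is impossible). [folklore] -/
theorem not_fadingMemory_tower {θ θ' γ C : ℝ} {Λ : ℕ → ℕ → ℝ} (hγ : 0 < γ) (hθ0 : 0 < θ)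
    (hlt : θ' < θ) (hΛ : HistLipschitz Λ γ (tower θ)) : ¬ FadingMemory C θ' Λ := by
  intro hF
  have hlow := moduli_lower_tower hγ hθ0.le hΛ
  have hC1 : 1 ≤ C := by
    have h0 := (hF 0 0 le_rfl).2
    have := hlow 0
    simp only [pow_zero, Nat.sub_self, mul_one] at this h0
    linarith
  have hC0 : 0 < C := by linarith
  obtain ⟨n, hn⟩ := exists_pow_lt_of_lt_one (x := 1 / C) (y := θ' / θ) (by positivity) (by rwa [div_lt_one hθ0])
  have h1 := hlow n
  have h2 := (hF n 0 (Nat.zero_le n)).2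
  rw [Nat.sub_zero] at h2
  -- `C·θ′^n < θ^n`
  have hθn : 0 < θ ^ n := pow_pos hθ0 n
  have h3 : C * θ' ^ n < θ ^ n := by
    rw [div_pow, div_lt_div_iff₀ hθn hC0, one_mul] at hn
    linarith [mul_comm (θ' ^ n) C]
  linarith

/-! ## §3 Packaging: the analytic exchange rate `θ ↦ θ` is exact -/

/-- **THE RATE `θ` OF `FadingFromRateAnalytic` IS EXACT.**  For `0 < θ < 1`, `γ > 0`, `r > 0`: (a) the tower satisfies the three shapes —
`ExtendsC`, `ScaleShiftRateC (θ(γ+r)) θ γ r`, `CoordAnalyticC ((γ+r)∕(1−θ)) γ r` — so `histLipschitz_fadingMemory_of_analytic` yields moduli with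
`FadingMemory … θ …` for `tower θ`; (b) no `Λ` with `HistLipschitz Λ γ (tower θ)` has `FadingMemory C θ′ Λ` for any `C` and any `θ′ < θ`. [folklore] -/
theorem analytic_rate_exact {θ γ r : ℝ} (hθ0 : 0 < θ) (hθ1 : θ < 1) (hγ : 0 < γ) (hr : 0 < r) :
    (ExtendsC (tower θ) (towerC θ) ∧ ScaleShiftRateC (θ * (γ + r)) θ γ r (towerC θ) ∧
        CoordAnalyticC ((γ + r) / (1 - θ)) γ r (towerC θ) ∧
        (HistLipschitz (fun k i => analyticConst (θ * (γ + r)) θ ((γ + r) / (1 - θ)) r * θ ^ (k - i)) γ (tower θ) ∧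
          FadingMemory (analyticConst (θ * (γ + r)) θ ((γ + r) / (1 - θ)) r) θ
            (fun k i => analyticConst (θ * (γ + r)) θ ((γ + r) / (1 - θ)) r * θ ^ (k - i)))) ∧
      ∀ (Λ : ℕ → ℕ → ℝ) (C θ' : ℝ), HistLipschitz Λ γ (tower θ) → θ' < θ → ¬ FadingMemory C θ' Λ := by
  have hγr : 0 ≤ γ + r := by linarith
  have hE := extendsC_tower θ
  have hS : ScaleShiftRateC (θ * (γ + r)) θ γ r (towerC θ) := scaleShiftRateC_tower hθ0.le
  have hA := coordAnalyticC_tower (γ := γ) (r := r) hθ0.le hθ1 hγr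
  exact ⟨⟨hE, hS, hA, histLipschitz_fadingMemory_of_analytic hE hS (by positivity) hθ0 hθ1 hA hr⟩,
    fun Λ C θ' hΛ hlt => not_fadingMemory_tower hγ hθ0 hlt hΛ⟩

end Summit.QuantumFields.BalabanUV.T4Continuum.Spine.NE4

end
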